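import Summits.QuantumFields.YangMills.Theorems.InfiniteVolumePerOrderCompactness
import HarnessLib

/-!
# Infinite volume by compactness with per-order collar constants on LARGE TORI ONLY: compactness and translations

Support file for `ThermodynamicCeilings.LargeVolumeCalibration` (stmt-QuantumFields-27693).  The landed per-order
engine (`InfiniteVolume.PerOrder.*`, files `InfiniteVolumePerOrder{Compactness,TorusScheme,CentreBase,IVData}`,
support of `TypicalExteriorCeilings.FactorialCalibration`) consumes a per-order torus collar bound `(Cn n/R⁴)ⁿ` on
EVERY odd torus with `4R+8 ≤ L`.  The route `ThermodynamicCeilings` delivers these ceilings only on LARGE tori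
`L ≥ L₀(β)` (its `LargeVolumeCeilings` currency).  This file re-runs the compactness/translation statements of the
engine with the hypothesis WEAKENED to `L₀ β ≤ L` (a threshold `L₀ : ℝ → ℕ`; the landed statements are the case
`L₀ ≡ 0`): the only place where a finite torus enters is the INHERITANCE `momentBound_oddTorusLimitPoints` of the
collar bound by an odd-torus limit state, which is an `L → ∞` statement along the state's strictly increasing defining
torus sides — eventually `≥ L₀ β` (`eventually_le_of_strictMono`).  Everything downstream is verbatim, citing the
landed abstract lemmas (`PerOrder.exists_subseq_limit_of_zdCollar`, `norm_tsum_weight_mul_le`, `translate_eq_of_tendsto`,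
…) BY NAME.

WHAT IS PROVED ([folklore]; soft analysis): `momentBound_oddTorusLimitPoints`, `exists_subseq_limit_oddTorusLimitPoints`,
`translateMulti_invariant_of_tendsto_oddTorusLimitPoints`, `exists_subseq_limit_translate_oddTorusLimitPoints` — the
landed statements with the extra binder `L₀ β ≤ L` in the hypothesis.

HONEST FRAMING: nothing here is a statement about Bałaban's renormalisation group, reflection positivity, a mass gap or
Clay; the ceilings are HYPOTHESES.  No summit is proved (rung R2a plumbing).  Width seat ym-line-sfw-p2-w2 g21.

References: Glimm–Jaffe (1987) §6.1; Osterwalder–Schrader CMP 42 (1975) §2; Chatterjee arXiv:1803.01950 §2.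
-/

set_option autoImplicit false

noncomputable section

open scoped BigOperators SchwartzMap
open MeasureTheory Filter Topology
open Literature.MathematicalPhysics.QuantumFieldTheory hiding ZdEdge
open Literature.MathematicalPhysics.QuantumLattice
open Literature.MathematicalPhysics.AQFT
open Literature.Probability.LatticeModels (box Site)
open Summit.QuantumFields.YangMills.Cruxes.OSLegsFromFemtoAndGap.DlrCollarTransfer
  (plane torusE exists_abs_plane_le continuous_plane isCylinder_plane)
open Summit.QuantumFields.YangMills.Theorems.OSLegsFromFemtoAndGap (exists_subseq_clm_limit)

namespace Summit.QuantumFields.YangMills.Theorems.InfiniteVolume.PerOrderLarge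

/-! ## §1 Inheritance of the per-order torus collar bound by odd-torus limit states -/

section Inheritance

variable {G : Type} [Group G] [TopologicalSpace G] [IsTopologicalGroup G] [CompactSpace G]
  [MeasurableSpace G] [BorelSpace G]

/-- **THE INHERITANCE, per-order constants.**  If the per-torus-centred mixed plane moments at torus-separated sites
are `≤ (Cn n/R⁴)ⁿ` on every odd torus with `4R+8 ≤ L` (`β ≥ β₄`, `1 ≤ R`, `R·a β ≤ ℓ₄`), then with the SAME constants
every `μ ∈ oddTorusLimitPoints r β` has `|∫ ∏ᵢ (plane qᵢ xᵢ − ∫ plane qᵢ xᵢ dμ) dμ| ≤ (Cn n/R⁴)ⁿ` for `ℤ⁴`-separated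
plane strings (verbatim `InfiniteVolume.momentBounds6_oddTorusLimitPoints` with `C ↦ Cn n`). [folklore] -/
theorem momentBound_oddTorusLimitPoints (r : LatticeRep G) {a : ℝ → ℝ} (Cn : ℕ → ℝ) (L₀ : ℝ → ℕ) {β₄ ℓ₄ : ℝ}
    (hMB : ∀ β : ℝ, β₄ ≤ β →
      ∀ (L n : ℕ) (q : Fin n → Fin 4 × Fin 4) (x : Fin n → (Fin 4 → ℤ)) (R : ℕ), (∀ i, (q i).1 < (q i).2) →
        1 ≤ R → (R : ℝ) * a β ≤ ℓ₄ → 4 * R + 8 ≤ L → L₀ β ≤ L →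
        (∀ i j : Fin n, i ≠ j → ∃ k : Fin 4,
          (2 * (R : ℤ) + 4) ≤ |((((x i k - x j k : ℤ) : ZMod (2 * L + 1))).valMinAbs : ℤ)|) →
        |torusE G r β L (fun U => ∏ i, (plane G r (q i) (x i) U - torusE G r β L (plane G r (q i) (x i))))| ≤
          (Cn n / (R : ℝ) ^ 4) ^ n)
    {β : ℝ} (hβ : β₄ ≤ β) {μ : Measure (LGConfig 4 G)} (hμ : μ ∈ oddTorusLimitPoints r β)
    {n : ℕ} (q : Fin n → Fin 4 × Fin 4) (x : Fin n → (Fin 4 → ℤ)) (R : ℕ) (hq : ∀ i, (q i).1 < (q i).2)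
    (hR : 1 ≤ R) (hRa : (R : ℝ) * a β ≤ ℓ₄)
    (hsep : ∀ i j : Fin n, i ≠ j → ∃ k : Fin 4, (2 * (R : ℤ) + 4) ≤ |x i k - x j k|) :
    |∫ U, ∏ i, (plane G r (q i) (x i) U - ∫ V, plane G r (q i) (x i) V ∂μ) ∂μ| ≤ (Cn n / (R : ℝ) ^ 4) ^ n := by
  obtain ⟨S, hS, hlim⟩ := hμ
  obtain ⟨Cp, hCp⟩ := exists_abs_plane_le (G := G) r
  refine abs_integral_centred_prod_le_of_eventually r.ρ r.continuous hlim (fun i => plane G r (q i) (x i))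
    (fun i => ⟨_, isCylinder_plane r (q i) (x i)⟩) (fun i => continuous_plane r (q i) (x i))
    (fun i => measurable_plane r (q i) (x i)) (fun i => ⟨Cp, hCp (q i) (x i)⟩) ?_
  filter_upwards [eventually_torusSeparated x hsep hS, eventually_le_of_strictMono hS (4 * R + 8),
    eventually_le_of_strictMono hS (L₀ β)] with k hsepk hRk hLk
  exact hMB β hβ (S k) n q x R hq hR hRa hRk hLk hsepk

end Inheritance

/-! ## §3 The compactness step for odd-torus limit states, per-order constants -/

section OddTorus

variable {G : Type} [Group G] [TopologicalSpace G] [IsTopologicalGroup G] [CompactSpace G]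
  [MeasurableSpace G] [BorelSpace G]

/-- **THE COMPACTNESS STEP FOR THERMODYNAMIC LIMIT STATES, per-order constants** (verbatim
`InfiniteVolume.exists_subseq_limit_oddTorusLimitPoints` with a per-order collar bound `(Cn n/R⁴)ⁿ` as hypothesis and
the per-order E0′ constant `K n`). [folklore] -/
theorem exists_subseq_limit_oddTorusLimitPoints (r : LatticeRep G) {a : ℝ → ℝ} (Cn : ℕ → ℝ) (L₀ : ℝ → ℕ) {β₄ ℓ₄ : ℝ}
    (hℓ : 0 < ℓ₄) (hC : ∀ n, 0 ≤ Cn n)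
    (H : ∀ β : ℝ, β₄ ≤ β →
      ∀ (L n : ℕ) (q : Fin n → Fin 4 × Fin 4) (x : Fin n → (Fin 4 → ℤ)) (R : ℕ), (∀ i, (q i).1 < (q i).2) →
        1 ≤ R → (R : ℝ) * a β ≤ ℓ₄ → 4 * R + 8 ≤ L → L₀ β ≤ L →
        (∀ i j : Fin n, i ≠ j → ∃ k : Fin 4,
          (2 * (R : ℤ) + 4) ≤ |((((x i k - x j k : ℤ) : ZMod (2 * L + 1))).valMinAbs : ℤ)|) →
        |torusE G r β L (fun U => ∏ i, (plane G r (q i) (x i) U - torusE G r β L (plane G r (q i) (x i))))| ≤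
          (Cn n / (R : ℝ) ^ 4) ^ n) :
    ∃ Cp : ℝ, 0 ≤ Cp ∧
      ∀ (β : ℕ → ℝ), (∀ k, β₄ ≤ β k) → (∀ k, 0 < a (β k)) → (∀ k, a (β k) ≤ 1 / 24) → (∀ k, a (β k) ≤ ℓ₄) →
      ∀ (μ : ℕ → Measure (LGConfig 4 G)), (∀ k, μ k ∈ oddTorusLimitPoints r (β k)) →
      ∀ (y : ℕ → (n : ℕ) → (Fin n → Fin 4 × Fin 4) → (Fin n → Site 4) → (Fin n → EuclideanSpace ℝ (Fin 4))),
        (∀ k n q x l, ‖y k n q x l - a (β k) • siteToE (x l)‖ ≤ 6 * a (β k)) →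
      ∃ φ : ℕ → ℕ, StrictMono φ ∧
        ∃ S : (n : ℕ) → (Fin n → Fin 4 × Fin 4) → (𝓢((Fin n → EuclideanSpace ℝ (Fin 4)), ℂ) →L[ℂ] ℂ),
          (∀ n q F, ‖S n q F‖ ≤
            5 * ((((Cp + Cp) * 4 ^ 4 * 5 ^ 6 + (Cp + Cp) * 2 ^ 6 * (10 + 2 * 6) ^ 4 +
              16 * Cn n * 2 ^ 6 * (2 / ℓ₄ + 48) ^ 4) * 2 ^ 6 * (81 * ∑' m : ℕ, (((m : ℝ) + 1) ^ 2)⁻¹)) ^ n) *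
              schwartzNorm (10 * n) F) ∧
          ∀ n : ℕ, 2 ≤ n → ∀ q : Fin n → Fin 4 × Fin 4, (∀ i, (q i).1 < (q i).2) →
            ∀ F : 𝓢((Fin n → EuclideanSpace ℝ (Fin 4)), ℂ), IsOffDiagonal F →
              Tendsto (fun j => ∑' x : Fin n → Site 4,
                (((∫ U, ∏ i, (plane G r (q i) (x i) U - ∫ V, plane G r (q i) (x i) V ∂(μ (φ j))) ∂(μ (φ j)) : ℝ)
                  : ℂ)) * F (y (φ j) n q x)) atTop (𝓝 (S n q F)) := by
  obtain ⟨Cp, hCp⟩ := exists_abs_plane_le (G := G) r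
  have hCp0 : 0 ≤ Cp := le_trans (abs_nonneg _) (hCp (0, 1) 0 (fun _ => 1))
  refine ⟨Cp, hCp0, ?_⟩
  intro β hβ ha ha24 haℓ μ hμ y hy
  haveI : ∀ k, IsProbabilityMeasure (μ k) := fun k => by
    obtain ⟨S, -, hlim⟩ := hμ k
    exact hlim.1
  obtain ⟨φ, hφ, S, hS, hconv⟩ := PerOrder.exists_subseq_limit_of_zdCollar Cn hℓ hC (by positivity : 0 ≤ Cp + Cp)
    (fun k => a (β k)) ha ha24 haℓ
    (fun k n q x => ∫ U, ∏ i, (plane G r (q i) (x i) U - ∫ V, plane G r (q i) (x i) V ∂(μ k)) ∂(μ k))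
    (fun k n q x => abs_infVolWeight_le r hCp (μ k) q x)
    (fun k n q hq x R hR hRa hsep => momentBound_oddTorusLimitPoints r Cn L₀ H (hβ k) (hμ k) q x R hq hR hRa hsep)
    y hy
  exact ⟨φ, hφ, S, hS, hconv⟩

/-- **TRANSLATION INVARIANCE OF THE LIMIT, per-order constants** (verbatim
`InfiniteVolume.translateMulti_invariant_of_tendsto_oddTorusLimitPoints` with `C ↦ Cn n`). [folklore] -/
theorem translateMulti_invariant_of_tendsto_oddTorusLimitPoints (r : LatticeRep G) {a : ℝ → ℝ} (Cn : ℕ → ℝ) (L₀ : ℝ → ℕ)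
    {β₄ ℓ₄ : ℝ} (hℓ : 0 < ℓ₄) (hC : ∀ n, 0 ≤ Cn n)
    (H : ∀ β : ℝ, β₄ ≤ β →
      ∀ (L n : ℕ) (q : Fin n → Fin 4 × Fin 4) (x : Fin n → (Fin 4 → ℤ)) (R : ℕ), (∀ i, (q i).1 < (q i).2) →
        1 ≤ R → (R : ℝ) * a β ≤ ℓ₄ → 4 * R + 8 ≤ L → L₀ β ≤ L →
        (∀ i j : Fin n, i ≠ j → ∃ k : Fin 4,
          (2 * (R : ℤ) + 4) ≤ |((((x i k - x j k : ℤ) : ZMod (2 * L + 1))).valMinAbs : ℤ)|) →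
        |torusE G r β L (fun U => ∏ i, (plane G r (q i) (x i) U - torusE G r β L (plane G r (q i) (x i))))| ≤
          (Cn n / (R : ℝ) ^ 4) ^ n)
    (β : ℕ → ℝ) (hβ : ∀ k, β₄ ≤ β k) (ha : ∀ k, 0 < a (β k)) (ha24 : ∀ k, a (β k) ≤ 1 / 24)
    (haℓ : ∀ k, a (β k) ≤ ℓ₄) (ha0 : Tendsto (fun k => a (β k)) atTop (𝓝 0))
    (μ : ℕ → Measure (LGConfig 4 G)) (hμ : ∀ k, μ k ∈ oddTorusLimitPoints r (β k))
    {n : ℕ} (hn : 2 ≤ n) (q : Fin n → Fin 4 × Fin 4) (hq : ∀ i, (q i).1 < (q i).2)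
    (o : ℕ → Fin n → EuclideanSpace ℝ (Fin 4)) (ho : ∀ k l, ‖o k l‖ ≤ 5 * a (β k))
    {φ : ℕ → ℕ} (hφ : StrictMono φ) (S : 𝓢((Fin n → EuclideanSpace ℝ (Fin 4)), ℂ) → ℂ)
    (hconv : ∀ F : 𝓢((Fin n → EuclideanSpace ℝ (Fin 4)), ℂ), IsOffDiagonal F →
      Tendsto (fun j => ∑' x : Fin n → Site 4,
        (((∫ U, ∏ i, (plane G r (q i) (x i) U - ∫ V, plane G r (q i) (x i) V ∂(μ (φ j))) ∂(μ (φ j)) : ℝ) : ℂ)) *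
          F (fun l => a (β (φ j)) • siteToE (x l) + o (φ j) l)) atTop (𝓝 (S F)))
    (t : EuclideanSpace ℝ (Fin 4)) (F : 𝓢((Fin n → EuclideanSpace ℝ (Fin 4)), ℂ)) (hF : IsOffDiagonal F) :
    S (translateMulti t F) = S F := by
  obtain ⟨Cp, hCp⟩ := exists_abs_plane_le (G := G) r
  have hCp0 : 0 ≤ Cp := le_trans (abs_nonneg _) (hCp (0, 1) 0 (fun _ => 1))
  haveI : ∀ k, IsProbabilityMeasure (μ k) := fun k => by
    obtain ⟨S', -, hlim⟩ := hμ k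
    exact hlim.1
  have ha1 : ∀ k, a (β k) ≤ 1 := fun k => (ha24 k).trans (by norm_num)
  have hsa : ∀ k, 6 * a (β k) ≤ 1 / 4 := fun k => by linarith [ha24 k]
  -- shorthand: weights, evaluation maps
  set W : ℕ → (Fin n → Site 4) → ℝ := fun k x =>
    ∫ U, ∏ i, (plane G r (q i) (x i) U - ∫ V, plane G r (q i) (x i) V ∂(μ k)) ∂(μ k) with hWdef
  set y : ℕ → (Fin n → Site 4) → (Fin n → EuclideanSpace ℝ (Fin 4)) := fun k x l =>
    a (β k) • siteToE (x l) + o k l with hydef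
  have hyx : ∀ k x l, ‖y k x l - a (β k) • siteToE (x l)‖ ≤ 6 * a (β k) := fun k x l => by
    simp only [hydef, add_sub_cancel_left]
    linarith [ho k l, (ha k).le]
  have hWsup : ∀ k x, |W k x| ≤ (Cp + Cp) ^ n := fun k x => abs_infVolWeight_le r hCp (μ k) q x
  have hWcol : ∀ k (x : Fin n → Site 4) (R : ℕ), 1 ≤ R → (R : ℝ) * a (β k) ≤ ℓ₄ →
      (∀ i j : Fin n, i ≠ j → ∃ m : Fin 4, (2 * (R : ℤ) + 4) ≤ |x i m - x j m|) →
      |W k x| ≤ (Cn n / (R : ℝ) ^ 4) ^ n := fun k x R hR hRa hsep =>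
    momentBound_oddTorusLimitPoints r Cn L₀ H (hβ k) (hμ k) q x R hq hR hRa hsep
  -- the functionals along `φ`
  set s : ℕ → 𝓢((Fin n → EuclideanSpace ℝ (Fin 4)), ℂ) → ℂ := fun j F =>
    ∑' x : Fin n → Site 4, ((W (φ j) x : ℝ) : ℂ) * F (y (φ j) x) with hsdef
  have hsum : ∀ j (F : 𝓢((Fin n → EuclideanSpace ℝ (Fin 4)), ℂ)),
      Summable fun x : Fin n → Site 4 => ((W (φ j) x : ℝ) : ℂ) * F (y (φ j) x) := fun j F =>
    summable_mul_of_bounded (ha (φ j)) (ha1 (φ j)) (hsa (φ j)) (pow_nonneg (by positivity) n) (W (φ j))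
      (hWsup (φ j)) F (y (φ j)) (hyx (φ j))
  have hsub : ∀ j (F G' : 𝓢((Fin n → EuclideanSpace ℝ (Fin 4)), ℂ)), IsOffDiagonal F → IsOffDiagonal G' →
      s j (F - G') = s j F - s j G' := fun j F G' _ _ => by
    simp only [hsdef]
    rw [← Summable.tsum_sub (hsum j F) (hsum j G')]
    exact tsum_congr fun x => by simp only [sub_apply]; ring
  set K : ℝ := ((Cp + Cp) * 4 ^ 4 * 5 ^ 6 + (Cp + Cp) * 2 ^ 6 * (10 + 2 * 6) ^ 4 +
      16 * Cn n * 2 ^ 6 * (2 / ℓ₄ + 48) ^ 4) * 2 ^ 6 * (81 * ∑' m : ℕ, (((m : ℝ) + 1) ^ 2)⁻¹) with hK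
  have hbd : ∀ j (F : 𝓢((Fin n → EuclideanSpace ℝ (Fin 4)), ℂ)), IsOffDiagonal F →
      ‖s j F‖ ≤ 5 * K ^ n * schwartzNorm (10 * n) F := fun j F hF =>
    norm_tsum_weight_mul_le hℓ (hC n) (by positivity : 0 ≤ Cp + Cp) (W (φ j)) (hWsup (φ j)) (hWcol (φ j))
      (ha (φ j)) (ha1 (φ j)) (haℓ (φ j)) hn (by norm_num) le_rfl (hsa (φ j)) F hF (y (φ j)) (hyx (φ j))
  -- lattice vectors approximating `t`, exact invariance along the sequence
  have hv := fun j => exists_latticeVector_near (ha (φ j)) t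
  choose v hv using hv
  have hbt : Tendsto (fun j => a (β (φ j)) • siteToE (v j)) atTop (𝓝 t) := by
    have ha0' : Tendsto (fun j => 2 * a (β (φ j))) atTop (𝓝 0) := by
      simpa using (ha0.comp hφ.tendsto_atTop).const_mul 2
    rw [tendsto_iff_norm_sub_tendsto_zero]
    refine squeeze_zero (fun j => norm_nonneg _) (fun j => ?_) ha0'
    rw [norm_sub_rev]; exact hv j
  have hinv : ∀ j (F : 𝓢((Fin n → EuclideanSpace ℝ (Fin 4)), ℂ)), IsOffDiagonal F →
      s j (translateMulti (a (β (φ j)) • siteToE (v j)) F) = s j F := fun j F _ => by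
    simp only [hsdef, hydef]
    exact tsum_weight_mul_translateMulti (W (φ j)) (v j)
      (fun x => infVolWeight_translate_oddTorusLimitPoints r (hμ (φ j)) q x (v j)) _ (o (φ j)) F
  exact translate_eq_of_tendsto s S hsub hbd hconv hbt hinv F hF

/-- **THE COMPACTNESS STEP WITH TRANSLATIONS, per-order constants** (verbatim
`InfiniteVolume.exists_subseq_limit_translate_oddTorusLimitPoints` with `C ↦ Cn n`, `K ↦ K n`; the sup constant
`Cₚ` of the plane fields is returned so that the E0′ constant is explicit and affine in `Cn n`). [folklore] -/
theorem exists_subseq_limit_translate_oddTorusLimitPoints (r : LatticeRep G) {a : ℝ → ℝ} (Cn : ℕ → ℝ) (L₀ : ℝ → ℕ)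
    {β₄ ℓ₄ : ℝ} (hℓ : 0 < ℓ₄) (hC : ∀ n, 0 ≤ Cn n)
    (H : ∀ β : ℝ, β₄ ≤ β →
      ∀ (L n : ℕ) (q : Fin n → Fin 4 × Fin 4) (x : Fin n → (Fin 4 → ℤ)) (R : ℕ), (∀ i, (q i).1 < (q i).2) →
        1 ≤ R → (R : ℝ) * a β ≤ ℓ₄ → 4 * R + 8 ≤ L → L₀ β ≤ L →
        (∀ i j : Fin n, i ≠ j → ∃ k : Fin 4,
          (2 * (R : ℤ) + 4) ≤ |((((x i k - x j k : ℤ) : ZMod (2 * L + 1))).valMinAbs : ℤ)|) →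
        |torusE G r β L (fun U => ∏ i, (plane G r (q i) (x i) U - torusE G r β L (plane G r (q i) (x i))))| ≤
          (Cn n / (R : ℝ) ^ 4) ^ n) :
    ∃ Cp : ℝ, 0 ≤ Cp ∧
      ∀ (β : ℕ → ℝ), (∀ k, β₄ ≤ β k) → (∀ k, 0 < a (β k)) → (∀ k, a (β k) ≤ 1 / 24) → (∀ k, a (β k) ≤ ℓ₄) →
        Tendsto (fun k => a (β k)) atTop (𝓝 0) →
      ∀ (μ : ℕ → Measure (LGConfig 4 G)), (∀ k, μ k ∈ oddTorusLimitPoints r (β k)) →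
      ∀ (o : ℕ → (n : ℕ) → (Fin n → Fin 4 × Fin 4) → Fin n → EuclideanSpace ℝ (Fin 4)),
        (∀ k n q l, ‖o k n q l‖ ≤ 5 * a (β k)) →
      ∃ φ : ℕ → ℕ, StrictMono φ ∧
        ∃ S : (n : ℕ) → (Fin n → Fin 4 × Fin 4) → (𝓢((Fin n → EuclideanSpace ℝ (Fin 4)), ℂ) →L[ℂ] ℂ),
          (∀ n q F, ‖S n q F‖ ≤
            5 * ((((Cp + Cp) * 4 ^ 4 * 5 ^ 6 + (Cp + Cp) * 2 ^ 6 * (10 + 2 * 6) ^ 4 +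
              16 * Cn n * 2 ^ 6 * (2 / ℓ₄ + 48) ^ 4) * 2 ^ 6 * (81 * ∑' m : ℕ, (((m : ℝ) + 1) ^ 2)⁻¹)) ^ n) *
              schwartzNorm (10 * n) F) ∧
          (∀ n : ℕ, 2 ≤ n → ∀ q : Fin n → Fin 4 × Fin 4, (∀ i, (q i).1 < (q i).2) →
            ∀ F : 𝓢((Fin n → EuclideanSpace ℝ (Fin 4)), ℂ), IsOffDiagonal F →
              Tendsto (fun j => ∑' x : Fin n → Site 4,
                (((∫ U, ∏ i, (plane G r (q i) (x i) U - ∫ V, plane G r (q i) (x i) V ∂(μ (φ j))) ∂(μ (φ j)) : ℝ)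
                  : ℂ)) * F (fun l => a (β (φ j)) • siteToE (x l) + o (φ j) n q l)) atTop (𝓝 (S n q F))) ∧
          ∀ n : ℕ, 2 ≤ n → ∀ q : Fin n → Fin 4 × Fin 4, (∀ i, (q i).1 < (q i).2) →
            ∀ (t : EuclideanSpace ℝ (Fin 4)) (F : 𝓢((Fin n → EuclideanSpace ℝ (Fin 4)), ℂ)), IsOffDiagonal F →
              S n q (translateMulti t F) = S n q F := by
  obtain ⟨Cp, hCp0, hex⟩ := exists_subseq_limit_oddTorusLimitPoints r Cn L₀ hℓ hC H
  refine ⟨Cp, hCp0, ?_⟩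
  intro β hβ ha ha24 haℓ ha0 μ hμ o ho
  have hy : ∀ k n (q : Fin n → Fin 4 × Fin 4) (x : Fin n → Site 4) l,
      ‖(fun l => a (β k) • siteToE (x l) + o k n q l) l - a (β k) • siteToE (x l)‖ ≤ 6 * a (β k) :=
    fun k n q x l => by
      simp only [add_sub_cancel_left]
      linarith [ho k n q l, (ha k).le]
  obtain ⟨φ, hφ, S, hS, hconv⟩ := hex β hβ ha ha24 haℓ μ hμ
    (fun k n q x l => a (β k) • siteToE (x l) + o k n q l) hy
  refine ⟨φ, hφ, S, hS, hconv, fun n hn q hq t F hF => ?_⟩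
  exact translateMulti_invariant_of_tendsto_oddTorusLimitPoints r Cn L₀ hℓ hC H β hβ ha ha24 haℓ ha0 μ hμ hn q hq
    (fun k => o k n q) (fun k l => ho k n q l) hφ (S n q) (hconv n hn q hq) t F hF

end OddTorus

end Summit.QuantumFields.YangMills.Theorems.InfiniteVolume.PerOrderLarge

end
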